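import Summits.QuantumFields.YangMills.Theorems.LuscherReductionRunningReductionPolyakovLine
import Summits.QuantumFields.YangMills.Theorems.LuscherReductionRunningReductionCombGaugeBox
import Summits.QuantumFields.YangMills.Theorems.LuscherReductionTwistedTraceScalingToronOrbit
import Literature.NumberTheory.DiophantineApproximation.KroneckerTheorem
import HarnessLib

/-!
# Negative lemma R24a (crux `TwistedTraceScaling`, stmt-QuantumFields-20203): a POLYAKOV-LINE FLOOR on the gauge-orbit distance and the two-sided size
# `orbitDist(V_θ) ≍ L³·Σ_k|θ_k|` of the constant abelian valley

Standing disprover `ym-cdisprove-20203-1` (gen 19), part 1 of 2 (part 2: `…Negative.ShellWitnessBelowThreshold`, the consequence for lane A's C4-SHELL architecture).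
Kernel-checked content:
* §1 ★ **Polyakov floor** (folklore: unitary triangle inequality + gauge covariance of the closed lines; new as a tree lemma):
  `‖P_k^{(n)}(U;x) − 1‖_F ≤ Σ_{t<n} ‖U(x+tê_k,k) − 1‖_F` (`frobNorm_lineProd_sub_one_le_sum`), gauge invariance of `‖P_k(U;x) − 1‖_F`
  (`frobNorm_lineProd_gaugeTransform_sub_one`), `Σ_{x,k} ‖P_k(V;x) − 1‖_F ≤ L·Σ_e ‖V_e − 1‖_F` (each link lies on `L` based closed lines of its direction) and,
  minimising over the gauge orbit, `Σ_{x,k} ‖P_k(U;x) − 1‖_F ≤ L · orbitDist U` (`sum_frobNorm_lineProd_sub_one_le_mul_orbitDist`) — a gauge-INVARIANT lower bound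
  on `orbitDist`, complementing the tree's per-line `re_trace_lineProd_ge_of_orbitDist_lt` (which loses the volume factor).
* §2 ★★ **the valley, two-sided**: `P_k^{(n)}(V_θ;x) = diagSU2 (nθ_k)` (`lineProd_abelianCfg`), `‖diagSU2 φ − 1‖_F = 2√2|sin(φ/2)|` (`frobNorm_diagSU2_sub_one_eq`), hence
  `2√2·L²·Σ_k |sin(Lθ_k/2)| ≤ orbitDist(V_θ)` (`orbitDist_abelianCfg_ge`) and, by Jordan's inequality, for `|θ_k| ≤ π/L`:
  `(2√2/π)·L³·Σ_k|θ_k| ≤ orbitDist(V_θ) ≤ √2·L³·Σ_k|θ_k|` (`orbitDist_abelianCfg_two_sided`; the upper bound is the tree's `orbitDist_abelianCfg_le`).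
  For constant abelian data the dictionary «orbit distance ↔ per-link angle (= one-site zero-mode radius)» therefore carries the factor `L³`, up to `[2√2/π, √2]`.

HONEST FRAMING: lattice kinematics in support of negative/tightness bookkeeping about stub S-BASE (C4) of a child of the CONDITIONAL reduction route R2b1 (rank 202);
nothing here is `¬TwistedTraceScaling`, nothing is a gap, nothing is Clay.  Not Mathlib material: project-specific.
-/

set_option autoImplicit false

noncomputable section

open Real Finset
open scoped Matrix ComplexConjugate BigOperators
open Literature.MathematicalPhysics.QuantumFieldTheory
open Literature.MathematicalPhysics.QuantumLattice
open Summit.QuantumFields.YangMills.Theorems.FemtoTransferGap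
open Summit.QuantumFields.YangMills.Theorems.FemtoTransferGap.TwoLattice.Toron

namespace Summit.QuantumFields.YangMills.Theorems.TwistedTraceScaling.Negative.R24

variable {L : ℕ}

/-! ## §1 The Polyakov-line floor on the orbit distance -/

section Floor

/-- `‖P_k^{(n)}(U;x) − 1‖_F ≤ Σ_{t<n} ‖U(x + tê_k, k) − 1‖_F` (unitary triangle inequality along the line). [cite: HornJohnson2013, Thm 2.2.2] -/
theorem frobNorm_lineProd_sub_one_le_sum (U : GaugeConfig 3 L SU2) (x : Site 3 L) (k : Fin 3) (n : ℕ) :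
    frobNorm (((lineProd U x k n : SU2) : Matrix (Fin 2) (Fin 2) ℂ) - 1) ≤
      ∑ t ∈ Finset.range n, frobNorm (((U (x + (Pi.single k ((t : ℕ) : ZMod L) : Site 3 L), k) : SU2) : Matrix (Fin 2) (Fin 2) ℂ) - 1) := by
  induction n with
  | zero => simp [lineProd, frobNorm_zero]
  | succ n ih =>
    rw [lineProd_succ, Finset.sum_range_succ]
    exact (frobNorm_mul_sub_one_le _ _).trans (by linarith)

/-- `‖P_k(U^g;x) − 1‖_F = ‖P_k(U;x) − 1‖_F`: the closed line is conjugated by `g(x)`. [cite: tHooft1979] -/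
theorem frobNorm_lineProd_gaugeTransform_sub_one (g : Site 3 L → SU2) (U : GaugeConfig 3 L SU2) (x : Site 3 L) (k : Fin 3) :
    frobNorm (((lineProd (gaugeTransform g U) x k L : SU2) : Matrix (Fin 2) (Fin 2) ℂ) - 1) =
      frobNorm (((lineProd U x k L : SU2) : Matrix (Fin 2) (Fin 2) ℂ) - 1) := by
  rw [lineProd_gaugeTransform_closed, frobNorm_conj_sub_one]

/-- Translation invariance of a sum over the sites of `(ℤ/L)³`. [folklore] -/
theorem sum_translate [NeZero L] (a : Site 3 L) (f : Site 3 L → ℝ) : ∑ x : Site 3 L, f (x + a) = ∑ x : Site 3 L, f x :=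
  Equiv.sum_comp (Equiv.addRight a) f

/-- `Σ_{x,k} ‖P_k(V;x) − 1‖_F ≤ L · Σ_e ‖V_e − 1‖_F`: each link lies on exactly `L` based closed lines of its direction. [folklore] -/
theorem sum_frobNorm_lineProd_sub_one_le [NeZero L] (V : GaugeConfig 3 L SU2) :
    ∑ x : Site 3 L, ∑ k : Fin 3, frobNorm (((lineProd V x k L : SU2) : Matrix (Fin 2) (Fin 2) ℂ) - 1) ≤
      (L : ℝ) * ∑ e : Edge 3 L, frobNorm (((V e : SU2) : Matrix (Fin 2) (Fin 2) ℂ) - 1) := by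
  calc ∑ x : Site 3 L, ∑ k : Fin 3, frobNorm (((lineProd V x k L : SU2) : Matrix (Fin 2) (Fin 2) ℂ) - 1)
      ≤ ∑ x : Site 3 L, ∑ k : Fin 3, ∑ t ∈ Finset.range L,
          frobNorm (((V (x + (Pi.single k ((t : ℕ) : ZMod L) : Site 3 L), k) : SU2) : Matrix (Fin 2) (Fin 2) ℂ) - 1) :=
        Finset.sum_le_sum fun x _ => Finset.sum_le_sum fun k _ => frobNorm_lineProd_sub_one_le_sum V x k L
    _ = ∑ k : Fin 3, ∑ t ∈ Finset.range L, ∑ x : Site 3 L,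
          frobNorm (((V (x + (Pi.single k ((t : ℕ) : ZMod L) : Site 3 L), k) : SU2) : Matrix (Fin 2) (Fin 2) ℂ) - 1) := by
        rw [Finset.sum_comm]
        exact Finset.sum_congr rfl fun k _ => Finset.sum_comm
    _ = ∑ k : Fin 3, ∑ t ∈ Finset.range L, ∑ x : Site 3 L, frobNorm (((V (x, k) : SU2) : Matrix (Fin 2) (Fin 2) ℂ) - 1) := by
        refine Finset.sum_congr rfl fun k _ => Finset.sum_congr rfl fun t _ => ?_
        exact sum_translate (Pi.single k ((t : ℕ) : ZMod L)) (fun y => frobNorm (((V (y, k) : SU2) : Matrix (Fin 2) (Fin 2) ℂ) - 1))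
    _ = (L : ℝ) * ∑ k : Fin 3, ∑ x : Site 3 L, frobNorm (((V (x, k) : SU2) : Matrix (Fin 2) (Fin 2) ℂ) - 1) := by
        rw [Finset.mul_sum]
        refine Finset.sum_congr rfl fun k _ => ?_
        rw [Finset.sum_const, Finset.card_range, nsmul_eq_mul]
    _ = (L : ℝ) * ∑ e : Edge 3 L, frobNorm (((V e : SU2) : Matrix (Fin 2) (Fin 2) ℂ) - 1) := by
        rw [Fintype.sum_prod_type]
        congr 1
        exact Finset.sum_comm

/-- ★ **Polyakov floor**: `Σ_{x,k} ‖P_k(U;x) − 1‖_F ≤ L · orbitDist U` — a gauge-INVARIANT lower bound on the gauge-orbit distance to the vacuum.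
[cite: Luscher1983, §2] [cite: tHooft1979] -/
theorem sum_frobNorm_lineProd_sub_one_le_mul_orbitDist [NeZero L] (U : GaugeConfig 3 L SU2) :
    ∑ x : Site 3 L, ∑ k : Fin 3, frobNorm (((lineProd U x k L : SU2) : Matrix (Fin 2) (Fin 2) ℂ) - 1) ≤ (L : ℝ) * orbitDist U := by
  obtain ⟨g, hg⟩ := exists_orbitDist_eq U
  have h := sum_frobNorm_lineProd_sub_one_le (gaugeTransform g U)
  simp_rw [frobNorm_lineProd_gaugeTransform_sub_one] at h
  rw [← hg]
  exact h

end Floor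

/-! ## §2 The constant abelian valley: closed lines and the two-sided size of `orbitDist(V_θ)` -/

section Valley

/-- The links of `V_θ`. [folklore] -/
theorem abelianCfg_apply (θ : Fin 3 → ℝ) (e : Edge 3 L) : abelianCfg L θ e = diagSU2 (θ e.2) := rfl

/-- `P_k^{(n)}(V_θ; x) = diag(e^{inθ_k}, e^{−inθ_k})`. [folklore] -/
theorem lineProd_abelianCfg (θ : Fin 3 → ℝ) (x : Site 3 L) (k : Fin 3) (n : ℕ) :
    lineProd (abelianCfg L θ) x k n = diagSU2 ((n : ℝ) * θ k) := by
  induction n with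
  | zero => simp [diagSU2_zero]
  | succ n ih =>
    rw [lineProd_succ, ih, abelianCfg_apply, ← diagSU2_add]
    congr 1
    push_cast
    ring

/-- `‖diag(e^{iφ}, e^{−iφ}) − 1‖_F = 2√2·|sin(φ/2)|`. [folklore] -/
theorem frobNorm_diagSU2_sub_one_eq (φ : ℝ) :
    frobNorm (((diagSU2 φ : SU2) : Matrix (Fin 2) (Fin 2) ℂ) - 1) = 2 * Real.sqrt 2 * |Real.sin (φ / 2)| := by
  have h := frobNorm_diagSU2_sub_one_sq φ
  have h2 : (2 : ℝ) * (φ / 2) = φ := by ring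
  have hs : Real.sin (φ / 2) ^ 2 = 1 / 2 - Real.cos φ / 2 := by
    rw [Real.sin_sq_eq_half_sub, h2]
  have h0 : 0 ≤ frobNorm (((diagSU2 φ : SU2) : Matrix (Fin 2) (Fin 2) ℂ) - 1) := frobNorm_nonneg _
  have h1 : 0 ≤ 2 * Real.sqrt 2 * |Real.sin (φ / 2)| := by positivity
  have hsq : frobNorm (((diagSU2 φ : SU2) : Matrix (Fin 2) (Fin 2) ℂ) - 1) ^ 2 = (2 * Real.sqrt 2 * |Real.sin (φ / 2)|) ^ 2 := by
    rw [h, mul_pow, mul_pow, sq_abs, Real.sq_sqrt (by norm_num : (0 : ℝ) ≤ 2), hs]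
    ring
  exact (pow_left_inj₀ h0 h1 two_ne_zero).mp hsq

/-- The number of sites of `(ℤ/L)³` is `L³`. [folklore] -/
theorem card_site [NeZero L] : (Fintype.card (Site 3 L) : ℝ) = (L : ℝ) ^ 3 := by
  rw [Fintype.card_pi, Finset.prod_const, Finset.card_univ, Fintype.card_fin, ZMod.card]
  push_cast
  ring

/-- ★ **Floor for the valley**: `2√2·L²·Σ_k |sin(Lθ_k/2)| ≤ orbitDist(V_θ)` (Polyakov floor; the closed lines of `V_θ` are `diagSU2 (Lθ_k)` at every site).
[cite: Luscher1983, §2] -/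
theorem orbitDist_abelianCfg_ge [NeZero L] (θ : Fin 3 → ℝ) :
    2 * Real.sqrt 2 * (L : ℝ) ^ 2 * ∑ k, |Real.sin ((L : ℝ) * θ k / 2)| ≤ orbitDist (abelianCfg L θ) := by
  have hL : (0 : ℝ) < L := by exact_mod_cast Nat.pos_of_ne_zero (NeZero.ne L)
  have hP : ∀ (x : Site 3 L) (k : Fin 3), frobNorm (((lineProd (abelianCfg L θ) x k L : SU2) : Matrix (Fin 2) (Fin 2) ℂ) - 1) =
      2 * Real.sqrt 2 * |Real.sin ((L : ℝ) * θ k / 2)| := fun x k => by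
    rw [lineProd_abelianCfg, frobNorm_diagSU2_sub_one_eq]
  have hle := sum_frobNorm_lineProd_sub_one_le_mul_orbitDist (abelianCfg L θ)
  simp_rw [hP] at hle
  rw [Finset.sum_const, Finset.card_univ, nsmul_eq_mul, card_site] at hle
  -- `hle : L³ · Σ_k 2√2|sin(Lθ_k/2)| ≤ L · orbitDist V_θ`
  have h3 : (L : ℝ) * (2 * Real.sqrt 2 * (L : ℝ) ^ 2 * ∑ k, |Real.sin ((L : ℝ) * θ k / 2)|) ≤ (L : ℝ) * orbitDist (abelianCfg L θ) := by
    calc (L : ℝ) * (2 * Real.sqrt 2 * (L : ℝ) ^ 2 * ∑ k, |Real.sin ((L : ℝ) * θ k / 2)|)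
        = (L : ℝ) ^ 3 * ∑ k, 2 * Real.sqrt 2 * |Real.sin ((L : ℝ) * θ k / 2)| := by rw [← Finset.mul_sum]; ring
      _ ≤ (L : ℝ) * orbitDist (abelianCfg L θ) := hle
  exact le_of_mul_le_mul_left h3 hL

/-- ★ **Linear floor** (Jordan): for `|θ_k| ≤ π/L`, `(2√2/π)·L³·Σ_k|θ_k| ≤ orbitDist(V_θ)`. [cite: Luscher1983, §2] -/
theorem orbitDist_abelianCfg_ge_linear [NeZero L] {θ : Fin 3 → ℝ} (hθ : ∀ k, |θ k| ≤ Real.pi / L) :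
    2 * Real.sqrt 2 / Real.pi * (L : ℝ) ^ 3 * ∑ k, |θ k| ≤ orbitDist (abelianCfg L θ) := by
  have hL : (0 : ℝ) < L := by exact_mod_cast Nat.pos_of_ne_zero (NeZero.ne L)
  refine le_trans ?_ (orbitDist_abelianCfg_ge θ)
  rw [Finset.mul_sum, Finset.mul_sum]
  refine Finset.sum_le_sum fun k _ => ?_
  have h1 : (L : ℝ) * |θ k| ≤ Real.pi := by
    calc (L : ℝ) * |θ k| ≤ (L : ℝ) * (Real.pi / L) := mul_le_mul_of_nonneg_left (hθ k) hL.le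
      _ = Real.pi := by field_simp
  have hy : |(L : ℝ) * θ k / 2| ≤ Real.pi / 2 := by
    rw [abs_div, abs_mul, abs_of_pos hL, abs_of_pos (two_pos : (0 : ℝ) < 2)]
    linarith
  have hj := Literature.NumberTheory.DiophantineApproximation.Kronecker.two_div_pi_mul_abs_le_abs_sin hy
  rw [abs_div, abs_mul, abs_of_pos hL, abs_of_pos (two_pos : (0 : ℝ) < 2)] at hj
  calc 2 * Real.sqrt 2 / Real.pi * (L : ℝ) ^ 3 * |θ k|
      = 2 * Real.sqrt 2 * (L : ℝ) ^ 2 * (2 / Real.pi * ((L : ℝ) * |θ k| / 2)) := by ring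
    _ ≤ 2 * Real.sqrt 2 * (L : ℝ) ^ 2 * |Real.sin ((L : ℝ) * θ k / 2)| := mul_le_mul_of_nonneg_left hj (by positivity)

/-- ★★ **Two-sided size of the valley's orbit distance**: for `|θ_k| ≤ π/L`, `(2√2/π)·L³·Σ_k|θ_k| ≤ orbitDist(V_θ) ≤ √2·L³·Σ_k|θ_k|` — the dictionary
«orbit distance ↔ per-link angle (= one-site zero-mode radius)» carries the factor `L³`. [cite: Luscher1983, §2] -/
theorem orbitDist_abelianCfg_two_sided [NeZero L] {θ : Fin 3 → ℝ} (hθ : ∀ k, |θ k| ≤ Real.pi / L) :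
    2 * Real.sqrt 2 / Real.pi * (L : ℝ) ^ 3 * ∑ k, |θ k| ≤ orbitDist (abelianCfg L θ) ∧
      orbitDist (abelianCfg L θ) ≤ Real.sqrt 2 * (L : ℝ) ^ 3 * ∑ k, |θ k| :=
  ⟨orbitDist_abelianCfg_ge_linear hθ, orbitDist_abelianCfg_le θ⟩

end Valley

end Summit.QuantumFields.YangMills.Theorems.TwistedTraceScaling.Negative.R24

end
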